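import Mathlib
import HarnessLib
import Summits.HubbardSuperconductivity.HubbardSuperconductivity.Theorems.KLProgrammeKLRegimeEngineTwoLegStepV17F2ClosersGridBinderCThrG
import Summits.HubbardSuperconductivity.HubbardSuperconductivity.Theorems.KLProgrammeKLRegimeEngineV17F2ClosersG
import Summits.HubbardSuperconductivity.HubbardSuperconductivity.Theorems.KLProgrammeKLRegimeEngineV8DefsU12bGQ
import Summits.HubbardSuperconductivity.HubbardSuperconductivity.Theorems.KLProgrammeKLRegimeEngineV8DefsQ9dG

/-!
# Route `KLProgramme` — ENGINE item stmt-HubbardSuperconductivity-20437 `KLRegimeEngineV17F2`, registration r16 V2 (α1) «A24∪A25∪Z∪α1»-G14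
# (image `engine-flow-v2x.r16-A24A25Za1-G14.lean` 27cd7ed0f55f17c0, `payload.skeleton` ts 2026-08-29T08:47:19Z):
# ROW (e) `stub_twoLeg_step` d9e0dae239cf AS A CLOSER MODULO THE VL LANE'S (e)-D-ROWS, IN REGISTERED SHAPE AT THE V2 TOKENS
# (cell gate-hubbard-kl, registrant seat gate-hubbard-kl-p1b g18; text of record ZE-DROWS-TEXT-r16.md d2e6a72f835f4295 (p1b g17, pen (R348)(B)(i)) re-keyed
# `klEngQ9c P R ↦ klEngQ9dG klEngGeo14 P R`, doors `klEngU₀12G8_* ↦ klEngU₀12GQ_*`, `klEngC₃7G ↦ klEngC₃7GU` — the three whole-identifier renames of (R394)(E))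

WHAT.  Rows (b), (C), (c) of the registered image each have a closer-modulo-producers in REGISTERED shape (`…EngineV8.A24a1G14.stub_engine_step_norms_of_producers`
p710057, `.stub_twoLeg_curvature_of_producers` p709580, `.stub_engine_step_values_of_producers` p711453).  This file gives row (e) the same:
**`EngineV8.A24a1G14.stub_twoLeg_step_of_dualRows hVL : <row (e) d9e0dae239cf VERBATIM>`**, where the ONE hypothesis `hVL` is the VL lane's (e)-D-ROWS package
(`TwoLegDualRowsPkgR16` of ZE-DROWS-TEXT-r16: `∃ d, 0 ≤ d ≤ Q.CL β 0/4, ∃ Dd Df Dc, (sum rows) ∧ (two-volume SPATIAL dual row) ∧ (two-volume MATSUBARA-CUT dual row)`,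
= the binders `hd hdCL hDsum hDc hdualSp hdualCut` of the landed closer `stub_twoLeg_step_of_gridBinderC_dualRows_raise_thr_G` (p609934) at `G := klEngGeo14`,
`Q := klEngQ9dG klEngGeo14 P R`) stated UNDER ROW (e)'s OWN BINDER PREFIX VERBATIM (all antecedents of (e), including the public levels bundle, the class-#1 exports
and the (R59w) grid binder `hGs` — the weakest hypothesis in registered currency; `d, Dd, Df, Dc` may depend on everything bound before them; supplier = VL lane
k3c4-p1, DROWS-SCOPE-g24.md v8 §10).  Proof = the landed closer with the V2 doors DISCHARGED in-text: `c ≤ klEngC₃6` by `klEngC₃7GU_le_klEngC₃6`; `U ≤ klEngU₀10` by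
`klEngU₀12GQ_le_klEngU₀10`; the three threshold rows by `klEngU₀12GQ_le_klTwoLegMomU` / `_le_inv_klZs2G` / (`klZs1G_mixedRow_of_doorsU` ∘ `_le_cz_klZs1G` / `_le_inv_klZs1G`);
the jet row `klC4aJetC2_le_klEngGeo14_S`; `IsRaiseOf` by `isRaiseOf_klEngQ9dG klEngGeo14`.  Landing-day credit shape for the registrant:
`theorem stub_twoLeg_step : <row (e)> := A24a1G14.stub_twoLeg_step_of_dualRows hVL` (or the one-application close `R16V2Rows.KLRegimeEngineV17F2_of_rows`).

Pure composition of landed theorems (no definition, no instance, no notation); CONDITIONAL: `hVL` is a HYPOTHESIS (the VL lane's open (e)-D-ROWS (M1)–(M7)) and is NOT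
asserted; nothing here asserts (e), any other row of 20437, VL, K3, the Kohn–Luttinger margin or superconductivity in the Hubbard model.  0 kit · 0 lit.
References: BGM 2006 §2.4 (2.36), §3 (3.65)–(3.70) (the two-leg / dispersion step this row formalises) [cite: BenfattoGiulianiMastropietro2006].
-/

noncomputable section

namespace Summit.HubbardSuperconductivity.HubbardSuperconductivity.Theorems.EngineV8.A24a1G14

set_option linter.dupNamespace false -- summit = problem name (single-conjunct summit), D-0017

open Real Finset Literature.MathematicalPhysics.QuantumLattice Literature.Probability.LatticeModels GrassmannAlgebra
open Literature.MathematicalPhysics.QuantumLattice.FermiRG Literature.MathematicalPhysics.QuantumLattice.BandSectorCounting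
open Summit.HubbardSuperconductivity.HubbardSuperconductivity.Theorems.KLProgrammeLegKernels
open Summit.HubbardSuperconductivity.HubbardSuperconductivity.Theorems.DispersionFlow
open Summit.HubbardSuperconductivity.HubbardSuperconductivity.Theorems.PerturbedFermiCurve
open Summit.HubbardSuperconductivity.HubbardSuperconductivity.Theorems.KLRegimeSplit
open Summit.HubbardSuperconductivity.HubbardSuperconductivity.Theorems.TwoPointAssembly
open Summit.HubbardSuperconductivity.HubbardSuperconductivity.Theorems.TwoVolumeDefect
open Summit.HubbardSuperconductivity.HubbardSuperconductivity.Theorems.TwoLegFourier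
open Summit.HubbardSuperconductivity.HubbardSuperconductivity.Theorems.EngineV8

set_option maxRecDepth 8192 in
set_option maxHeartbeats 1600000 in -- long binder lists (row (e) + the inlined (e)-D-ROWS package)
/-- **ROW (e) OF THE REGISTERED IMAGE 27cd7ed0f55f17c0 (`stub_twoLeg_step`, sha12 d9e0dae239cf) MODULO THE VL LANE'S (e)-D-ROWS**: the conclusion is the registered
text verbatim; the hypothesis `hVL` is row (e)'s binder prefix verbatim followed by the (e)-D-ROWS package of ZE-DROWS-TEXT-r16 at the V2 tokens
(`G = klEngGeo14`, `Q = klEngQ9dG klEngGeo14 P R`).  Becomes the (e) STUB CREDIT the minute `hVL` is a landed theorem.  CONDITIONAL: nothing asserts `hVL`. -/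
theorem stub_twoLeg_step_of_dualRows
    (hVL :
      ∀ (P : SplitConsts) (R : RenConsts) (c : ℝ), P.WF → R.WF2 → 0 < c → c ≤ klEngC₃7GU klEngGeo14 P R →
      ∀ μ ∈ klWindowC, ∀ U : ℝ, 0 < U → U ≤ klEngU₀12GQ klEngGeo14 (klEngQ9dG klEngGeo14 P R) P R c → ∀ β : ℝ, klBetaMin ≤ β → β ≤ Real.exp (c / U ^ 2) →
      ∀ (L M : ℕ) [NeZero L] [NeZero M], klEngL₄ P R β U ≤ L → klEngM₃ β U L ≤ M →
      ∀ n : ℕ, 1 ≤ n → n ≤ nScales β + 1 → IsKLRegime U c (-(n : ℤ)) →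
      HistP klPredsV17F2 L M klEngGeo14 P (klEngQ9dG klEngGeo14 P R) R β U μ 0 n →
      FrameOK R U (nScales β) μ (klFlowFrameU L M β U μ n) →
      EngineBoundsAtV17F2 L M klEngGeo14 P (klEngQ9dG klEngGeo14 P R) β U μ n →
      TwoLegReadJetBound L M klC4aJetC2 (klC4aJetC' P R) β U μ (klFlowFrameU L M β U μ n) n →
      (∀ j ≤ n, (KernelNormsLevels L M P (klEngQ9dG klEngGeo14 P R) β U μ (klFlowFrameU L M β U μ n) j ∧
      KernelNormsWt4 L M (klWtBudget P (klEngQ9dG klEngGeo14 P R) U j) β U μ (klFlowFrameU L M β U μ n) j)) →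
      (∀ j ≤ n, LevelsUExportMixedAt L M (klCU2 P R (klEngQ7 P R)) P β U μ j) →
      (∀ n' ≤ n, ∀ (L₁ M₁ : ℕ) [NeZero L₁] [NeZero M₁], L ≤ L₁ → (klEngQ9dG klEngGeo14 P R).M0 β L₁ ≤ M₁ →
      (∀ j < n', histV17F2 L₁ M₁ klEngGeo14 P (klEngQ9dG klEngGeo14 P R) R β U μ j ∧
      TwoLegSlopes L₁ M₁ R β U μ (klFlowFrameU L₁ M₁ β U μ j) j) →
      TwoLegGridMomentsAtC L₁ M₁ (klZtG klEngGeo14 P R) (klZs1G klEngGeo14 P R) (klZs2G klEngGeo14 P R) c β U μ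
      (klFlowFrameU L₁ M₁ β U μ n') n') →
      ∃ d : ℝ, 0 ≤ d ∧ d ≤ (klEngQ9dG klEngGeo14 P R).CL β 0 / 4 ∧ ∃ Dd Df Dc : ℕ → ℝ,
        (∀ n' ≤ n, Dd n' + Df n' ≤ d * (4 : ℝ) ^ n' / 3) ∧
        (∀ n' ≤ n, Dc n' ≤ d * (4 : ℝ) ^ n' / 3) ∧
        (∀ n' ≤ n, ∀ (Mq : ℕ → ℕ) (L₁ L₂ M₂ : ℕ) [NeZero L₁] [NeZero L₂] [NeZero M₂], L ≤ L₁ → L₁ ∣ L₂ → (klEngQ9dG klEngGeo14 P R).M0 β L₁ ≤ M₂ →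
        Mq L₁ ≤ M₂ → (klEngQ9dG klEngGeo14 P R).M0 β L₂ ≤ M₂ → Mq L₂ ≤ M₂ →
        (∀ j < n', histV17F2 L₁ M₂ klEngGeo14 P (klEngQ9dG klEngGeo14 P R) R β U μ j ∧ TwoLegSlopes L₁ M₂ R β U μ (klFlowFrameU L₁ M₂ β U μ j) j) →
        (∀ j < n', histV17F2 L₂ M₂ klEngGeo14 P (klEngQ9dG klEngGeo14 P R) R β U μ j ∧ TwoLegSlopes L₂ M₂ R β U μ (klFlowFrameU L₂ M₂ β U μ j) j) →
        (∀ m < n', ∀ θ : ℝ, |klLocalPart L₁ M₂ β U μ (klFlowFrameU L₁ M₂ β U μ m) m θ -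
        klLocalPart L₂ M₂ β U μ (klFlowFrameU L₂ M₂ β U μ m) m θ| ≤ d * (4 : ℝ) ^ m / L₁) →
        (∀ q : Fin 2 → ℝ, |(klFlowFrameU L₁ M₂ β U μ n').eval q - (klFlowFrameU L₂ M₂ β U μ n').eval q| ≤
        (∑ m ∈ range n', d * (4 : ℝ) ^ m) / L₁) →
        ∃ (oc : SpaceTimeIdx L₁ M₂) (of : SpaceTimeIdx L₂ M₂),
        (∀ m ∈ ({omega0 M₂, (omega0 M₂).rev} : Finset (MatsubaraIdx M₂)), ∀ σ : Fin 2, imagTimeWeight β M₂ * ∑ ybar : TorusSite 2 L₁,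
        (‖(∑ t₁ : ImagTimeIdx M₂,
        sectorisedKernel L₁ M₂ β (trivialMultiplier L₁ M₂)
        (klEffectiveAction L₁ M₂ β U μ (klFlowFrameU L₁ M₂ β U μ n') klE0 n' - counterQuadratic L₁ M₂ β (klFlowFrameU L₁ M₂ β U μ n')) 2
        (![((0, σ), 0), ((0, σ), 1)] : Fin 2 → SectorLeg 1) ![oc, (t₁, oc.2 + ybar)] *
        Complex.exp (((matsubaraFreq β M₂ m * (imagTime β M₂ oc.1 - imagTime β M₂ t₁) : ℝ) : ℂ) * Complex.I)) -
        (∑ t₁ : ImagTimeIdx M₂,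
        sectorisedKernel L₂ M₂ β (trivialMultiplier L₂ M₂)
        (klEffectiveAction L₂ M₂ β U μ (klFlowFrameU L₂ M₂ β U μ n') klE0 n' - counterQuadratic L₂ M₂ β (klFlowFrameU L₂ M₂ β U μ n')) 2
        (![((0, σ), 0), ((0, σ), 1)] : Fin 2 → SectorLeg 1) ![of, (t₁, of.2 + Torus.proj L₂ (Torus.cRep ybar))] *
        Complex.exp (((matsubaraFreq β M₂ m * (imagTime β M₂ of.1 - imagTime β M₂ t₁) : ℝ) : ℂ) * Complex.I))‖ +
        ‖(∑ t₁ : ImagTimeIdx M₂,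
        sectorisedKernel L₁ M₂ β (trivialMultiplier L₁ M₂)
        (klEffectiveAction L₁ M₂ β U μ (klFlowFrameU L₁ M₂ β U μ n') klE0 n' - counterQuadratic L₁ M₂ β (klFlowFrameU L₁ M₂ β U μ n')) 2
        (![((0, σ), 0), ((0, σ), 1)] : Fin 2 → SectorLeg 1) ![oc, (t₁, oc.2 + -ybar)] *
        Complex.exp (((matsubaraFreq β M₂ m * (imagTime β M₂ oc.1 - imagTime β M₂ t₁) : ℝ) : ℂ) * Complex.I)) -
        (∑ t₁ : ImagTimeIdx M₂,
        sectorisedKernel L₂ M₂ β (trivialMultiplier L₂ M₂)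
        (klEffectiveAction L₂ M₂ β U μ (klFlowFrameU L₂ M₂ β U μ n') klE0 n' - counterQuadratic L₂ M₂ β (klFlowFrameU L₂ M₂ β U μ n')) 2
        (![((0, σ), 0), ((0, σ), 1)] : Fin 2 → SectorLeg 1) ![of, (t₁, of.2 + -Torus.proj L₂ (Torus.cRep ybar))] *
        Complex.exp (((matsubaraFreq β M₂ m * (imagTime β M₂ of.1 - imagTime β M₂ t₁) : ℝ) : ℂ) * Complex.I))‖) ≤ Dd n' / L₁) ∧
        (∀ m ∈ ({omega0 M₂, (omega0 M₂).rev} : Finset (MatsubaraIdx M₂)), ∀ σ : Fin 2, imagTimeWeight β M₂ *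
        ∑ y ∈ univ.filter (fun y : TorusSite 2 L₂ => Torus.proj L₂ (Torus.cRep (fun i => (((y i).val : ℕ) : ZMod L₁))) ≠ y),
        (‖(∑ t₁ : ImagTimeIdx M₂,
        sectorisedKernel L₂ M₂ β (trivialMultiplier L₂ M₂)
        (klEffectiveAction L₂ M₂ β U μ (klFlowFrameU L₂ M₂ β U μ n') klE0 n' - counterQuadratic L₂ M₂ β (klFlowFrameU L₂ M₂ β U μ n')) 2
        (![((0, σ), 0), ((0, σ), 1)] : Fin 2 → SectorLeg 1) ![of, (t₁, of.2 + y)] *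
        Complex.exp (((matsubaraFreq β M₂ m * (imagTime β M₂ of.1 - imagTime β M₂ t₁) : ℝ) : ℂ) * Complex.I))‖ +
        ‖(∑ t₁ : ImagTimeIdx M₂,
        sectorisedKernel L₂ M₂ β (trivialMultiplier L₂ M₂)
        (klEffectiveAction L₂ M₂ β U μ (klFlowFrameU L₂ M₂ β U μ n') klE0 n' - counterQuadratic L₂ M₂ β (klFlowFrameU L₂ M₂ β U μ n')) 2
        (![((0, σ), 0), ((0, σ), 1)] : Fin 2 → SectorLeg 1) ![of, (t₁, of.2 + -y)] *
        Complex.exp (((matsubaraFreq β M₂ m * (imagTime β M₂ of.1 - imagTime β M₂ t₁) : ℝ) : ℂ) * Complex.I))‖) ≤ Df n' / L₁)) ∧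
        (∀ n' ≤ n, ∀ (Mq : ℕ → ℕ) (L₁ M₁ M₂ : ℕ) [NeZero L₁] [NeZero M₁] [NeZero M₂], L ≤ L₁ → (klEngQ9dG klEngGeo14 P R).M0 β L₁ ≤ M₁ → Mq L₁ ≤ M₁ →
        M₁ ≤ M₂ →
        (∀ j < n', histV17F2 L₁ M₁ klEngGeo14 P (klEngQ9dG klEngGeo14 P R) R β U μ j ∧ TwoLegSlopes L₁ M₁ R β U μ (klFlowFrameU L₁ M₁ β U μ j) j) →
        (∀ j < n', histV17F2 L₁ M₂ klEngGeo14 P (klEngQ9dG klEngGeo14 P R) R β U μ j ∧ TwoLegSlopes L₁ M₂ R β U μ (klFlowFrameU L₁ M₂ β U μ j) j) →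
        (∀ m < n', ∀ θ : ℝ, |klLocalPart L₁ M₁ β U μ (klFlowFrameU L₁ M₁ β U μ m) m θ -
        klLocalPart L₁ M₂ β U μ (klFlowFrameU L₁ M₂ β U μ m) m θ| ≤ d * (4 : ℝ) ^ m / L₁) →
        (∀ q : Fin 2 → ℝ, |(klFlowFrameU L₁ M₁ β U μ n').eval q - (klFlowFrameU L₁ M₂ β U μ n').eval q| ≤
        (∑ m ∈ range n', d * (4 : ℝ) ^ m) / L₁) →
        ∃ (o₁ : SpaceTimeIdx L₁ M₁) (o₂ : SpaceTimeIdx L₁ M₂),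
        (∀ σ : Fin 2, ∑ y : TorusSite 2 L₁,
        (‖(imagTimeWeight β M₁ : ℂ) * (∑ t₁ : ImagTimeIdx M₁,
        sectorisedKernel L₁ M₁ β (trivialMultiplier L₁ M₁)
        (klEffectiveAction L₁ M₁ β U μ (klFlowFrameU L₁ M₁ β U μ n') klE0 n' - counterQuadratic L₁ M₁ β (klFlowFrameU L₁ M₁ β U μ n')) 2
        (![((0, σ), 0), ((0, σ), 1)] : Fin 2 → SectorLeg 1) ![o₁, (t₁, o₁.2 + y)] *
        Complex.exp (((matsubaraFreq β M₁ (omega0 M₁) * (imagTime β M₁ o₁.1 - imagTime β M₁ t₁) : ℝ) : ℂ) * Complex.I)) -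
        (imagTimeWeight β M₂ : ℂ) * (∑ t₁ : ImagTimeIdx M₂,
        sectorisedKernel L₁ M₂ β (trivialMultiplier L₁ M₂)
        (klEffectiveAction L₁ M₂ β U μ (klFlowFrameU L₁ M₂ β U μ n') klE0 n' - counterQuadratic L₁ M₂ β (klFlowFrameU L₁ M₂ β U μ n')) 2
        (![((0, σ), 0), ((0, σ), 1)] : Fin 2 → SectorLeg 1) ![o₂, (t₁, o₂.2 + y)] *
        Complex.exp (((matsubaraFreq β M₂ (omega0 M₂) * (imagTime β M₂ o₂.1 - imagTime β M₂ t₁) : ℝ) : ℂ) * Complex.I))‖ +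
        ‖(imagTimeWeight β M₁ : ℂ) * (∑ t₁ : ImagTimeIdx M₁,
        sectorisedKernel L₁ M₁ β (trivialMultiplier L₁ M₁)
        (klEffectiveAction L₁ M₁ β U μ (klFlowFrameU L₁ M₁ β U μ n') klE0 n' - counterQuadratic L₁ M₁ β (klFlowFrameU L₁ M₁ β U μ n')) 2
        (![((0, σ), 0), ((0, σ), 1)] : Fin 2 → SectorLeg 1) ![o₁, (t₁, o₁.2 + -y)] *
        Complex.exp (((matsubaraFreq β M₁ (omega0 M₁) * (imagTime β M₁ o₁.1 - imagTime β M₁ t₁) : ℝ) : ℂ) * Complex.I)) -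
        (imagTimeWeight β M₂ : ℂ) * (∑ t₁ : ImagTimeIdx M₂,
        sectorisedKernel L₁ M₂ β (trivialMultiplier L₁ M₂)
        (klEffectiveAction L₁ M₂ β U μ (klFlowFrameU L₁ M₂ β U μ n') klE0 n' - counterQuadratic L₁ M₂ β (klFlowFrameU L₁ M₂ β U μ n')) 2
        (![((0, σ), 0), ((0, σ), 1)] : Fin 2 → SectorLeg 1) ![o₂, (t₁, o₂.2 + -y)] *
        Complex.exp (((matsubaraFreq β M₂ (omega0 M₂) * (imagTime β M₂ o₂.1 - imagTime β M₂ t₁) : ℝ) : ℂ) * Complex.I))‖) ≤ Dc n' / L₁) ∧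
        (∀ σ : Fin 2, ∑ y : TorusSite 2 L₁,
        (‖(imagTimeWeight β M₁ : ℂ) * (∑ t₁ : ImagTimeIdx M₁,
        sectorisedKernel L₁ M₁ β (trivialMultiplier L₁ M₁)
        (klEffectiveAction L₁ M₁ β U μ (klFlowFrameU L₁ M₁ β U μ n') klE0 n' - counterQuadratic L₁ M₁ β (klFlowFrameU L₁ M₁ β U μ n')) 2
        (![((0, σ), 0), ((0, σ), 1)] : Fin 2 → SectorLeg 1) ![o₁, (t₁, o₁.2 + y)] *
        Complex.exp (((matsubaraFreq β M₁ (omega0 M₁).rev * (imagTime β M₁ o₁.1 - imagTime β M₁ t₁) : ℝ) : ℂ) * Complex.I)) -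
        (imagTimeWeight β M₂ : ℂ) * (∑ t₁ : ImagTimeIdx M₂,
        sectorisedKernel L₁ M₂ β (trivialMultiplier L₁ M₂)
        (klEffectiveAction L₁ M₂ β U μ (klFlowFrameU L₁ M₂ β U μ n') klE0 n' - counterQuadratic L₁ M₂ β (klFlowFrameU L₁ M₂ β U μ n')) 2
        (![((0, σ), 0), ((0, σ), 1)] : Fin 2 → SectorLeg 1) ![o₂, (t₁, o₂.2 + y)] *
        Complex.exp (((matsubaraFreq β M₂ (omega0 M₂).rev * (imagTime β M₂ o₂.1 - imagTime β M₂ t₁) : ℝ) : ℂ) * Complex.I))‖ +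
        ‖(imagTimeWeight β M₁ : ℂ) * (∑ t₁ : ImagTimeIdx M₁,
        sectorisedKernel L₁ M₁ β (trivialMultiplier L₁ M₁)
        (klEffectiveAction L₁ M₁ β U μ (klFlowFrameU L₁ M₁ β U μ n') klE0 n' - counterQuadratic L₁ M₁ β (klFlowFrameU L₁ M₁ β U μ n')) 2
        (![((0, σ), 0), ((0, σ), 1)] : Fin 2 → SectorLeg 1) ![o₁, (t₁, o₁.2 + -y)] *
        Complex.exp (((matsubaraFreq β M₁ (omega0 M₁).rev * (imagTime β M₁ o₁.1 - imagTime β M₁ t₁) : ℝ) : ℂ) * Complex.I)) -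
        (imagTimeWeight β M₂ : ℂ) * (∑ t₁ : ImagTimeIdx M₂,
        sectorisedKernel L₁ M₂ β (trivialMultiplier L₁ M₂)
        (klEffectiveAction L₁ M₂ β U μ (klFlowFrameU L₁ M₂ β U μ n') klE0 n' - counterQuadratic L₁ M₂ β (klFlowFrameU L₁ M₂ β U μ n')) 2
        (![((0, σ), 0), ((0, σ), 1)] : Fin 2 → SectorLeg 1) ![o₂, (t₁, o₂.2 + -y)] *
        Complex.exp (((matsubaraFreq β M₂ (omega0 M₂).rev * (imagTime β M₂ o₂.1 - imagTime β M₂ t₁) : ℝ) : ℂ) * Complex.I))‖) ≤ Dc n' / L₁))) :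
    ∀ (P : SplitConsts) (R : RenConsts) (c : ℝ), P.WF → R.WF2 → 0 < c → c ≤ klEngC₃7GU klEngGeo14 P R →
      ∀ μ ∈ klWindowC, ∀ U : ℝ, 0 < U → U ≤ klEngU₀12GQ klEngGeo14 (klEngQ9dG klEngGeo14 P R) P R c → ∀ β : ℝ, klBetaMin ≤ β → β ≤ Real.exp (c / U ^ 2) →
      ∀ (L M : ℕ) [NeZero L] [NeZero M], klEngL₄ P R β U ≤ L → klEngM₃ β U L ≤ M →
      ∀ n : ℕ, 1 ≤ n → n ≤ nScales β + 1 → IsKLRegime U c (-(n : ℤ)) →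
      HistP klPredsV17F2 L M klEngGeo14 P (klEngQ9dG klEngGeo14 P R) R β U μ 0 n →
      FrameOK R U (nScales β) μ (klFlowFrameU L M β U μ n) →
      EngineBoundsAtV17F2 L M klEngGeo14 P (klEngQ9dG klEngGeo14 P R) β U μ n →
      TwoLegReadJetBound L M klC4aJetC2 (klC4aJetC' P R) β U μ (klFlowFrameU L M β U μ n) n →
      (∀ j ≤ n, (KernelNormsLevels L M P (klEngQ9dG klEngGeo14 P R) β U μ (klFlowFrameU L M β U μ n) j ∧
      KernelNormsWt4 L M (klWtBudget P (klEngQ9dG klEngGeo14 P R) U j) β U μ (klFlowFrameU L M β U μ n) j)) →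
      (∀ j ≤ n, LevelsUExportMixedAt L M (klCU2 P R (klEngQ7 P R)) P β U μ j) →
      (∀ n' ≤ n, ∀ (L₁ M₁ : ℕ) [NeZero L₁] [NeZero M₁], L ≤ L₁ → (klEngQ9dG klEngGeo14 P R).M0 β L₁ ≤ M₁ →
      (∀ j < n', histV17F2 L₁ M₁ klEngGeo14 P (klEngQ9dG klEngGeo14 P R) R β U μ j ∧
      TwoLegSlopes L₁ M₁ R β U μ (klFlowFrameU L₁ M₁ β U μ j) j) →
      TwoLegGridMomentsAtC L₁ M₁ (klZtG klEngGeo14 P R) (klZs1G klEngGeo14 P R) (klZs2G klEngGeo14 P R) c β U μ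
      (klFlowFrameU L₁ M₁ β U μ n') n') →
      TwoLegStepV17F2 L M klEngGeo14 P (klEngQ9dG klEngGeo14 P R) R β U μ n :=
  fun P R c hP hR hc hc3 μ hμ U hU hUle β hβ hβc L M _ _ hL hM n hn1 hn hreg hhist hfr hE hJ hlev hlevU hGs => by
    obtain ⟨d, hd, hdCL, Dd, Df, Dc, hDsum, hDc, hdualSp, hdualCut⟩ :=
      hVL P R c hP hR hc hc3 μ hμ U hU hUle β hβ hβc L M hL hM n hn1 hn hreg hhist hfr hE hJ hlev hlevU hGs
    have hZ1 : 0 ≤ klZs1G klEngGeo14 P R := klZs1G_nonneg klEngGeo14 P R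
    have hU3 : U ≤ 1 / (20 * (klZs1G klEngGeo14 P R + 1)) := hUle.trans (klEngU₀12GQ_le_inv_klZs1G klEngGeo14 (klEngQ9dG klEngGeo14 P R) P R c)
    have hU1 : U ≤ 1 := by
      refine hU3.trans ?_
      rw [div_le_one (by positivity)]
      linarith
    exact stub_twoLeg_step_of_gridBinderC_dualRows_raise_thr_G klEngGeo14 P R c (klEngQ9dG klEngGeo14 P R) (isRaiseOf_klEngQ9dG klEngGeo14 P R)
      klC4aJetC2 klC4aJetC2_le_klEngGeo14_S hP hR hc (hc3.trans (klEngC₃7GU_le_klEngC₃6 klEngGeo14 P R)) μ hμ U hU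
      (hUle.trans (klEngU₀12GQ_le_klEngU₀10 klEngGeo14 (klEngQ9dG klEngGeo14 P R) P R c)) β hβ hβc L M hL hM n hn1 hn hreg hhist hfr hE hJ
      (hUle.trans (klEngU₀12GQ_le_klTwoLegMomU klEngGeo14 (klEngQ9dG klEngGeo14 P R) P R c))
      (hUle.trans (klEngU₀12GQ_le_inv_klZs2G klEngGeo14 (klEngQ9dG klEngGeo14 P R) P R c))
      (klZs1G_mixedRow_of_doorsU hc3 hU hU1 (hUle.trans (klEngU₀12GQ_le_cz_klZs1G klEngGeo14 (klEngQ9dG klEngGeo14 P R) P R c)) hU3)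
      hGs hd hdCL hDsum hDc hdualSp hdualCut

end Summit.HubbardSuperconductivity.HubbardSuperconductivity.Theorems.EngineV8.A24a1G14

end
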